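import Summits.MatrixMultiplication.MatrixMultiplication.Theses.TaftSchemes
import Literature.Computability.AlgebraicComplexity.MatrixMultiplicationConjectureForms

/-!
# Crux-strategist audit of `TaftSeedSchemes` (stmt-MatrixMultiplication-16130): typed
decomposition attempts

Route `MatrixMultiplication/TaftSchemes`; deciding crux `X := TaftSeedSchemes` was audited
RESTATED / AT-LEAST-SUMMIT (an `ω = 2` witness — orbit sums of `s` seeds plus `r₀` invariant
triads form a decomposition of `⟨n,n,n⟩` of length `n·s + r₀ ≤ n^{2+ε}` — carrying an extra
Taft-closure constraint). This file names the route's inlined operators (`wt`, `Kop`, `Xop`),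
proves `X` unfolds to the named form definitionally, types the candidate decompositions
`X₁ ∧ … ∧ X_k → X` that were tried and, for each, the Lean fact that makes it fail the BC2-redirect
test ((a) every piece load-bearing, (b) assembly proved, (c) no piece gives `X` or the summit
`S := MatrixMultiplication` on its own, (d) a plan per open piece). Companion prose:
`STRATEGY-CENSUS.md` in the same crux directory. Nothing here is a route item. Sorry-free.
-/

set_option linter.dupNamespace false
set_option linter.unusedVariables false

noncomputable section

namespace Summit.MatrixMultiplication.MatrixMultiplication.Cruxes.TaftSeedSchemes.Strategist

open scoped BigOperators
open Literature.Computability.AlgebraicComplexity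
open Summit.MatrixMultiplication.MatrixMultiplication.Theses.TaftSchemes

/-! ## The route's inlined operators, named -/

/-- The tensor format `(Fin n × Fin n)^3 → ℂ` of `⟨n,n,n⟩`. -/
abbrev Tn (n : ℕ) : Type := Fin n × Fin n → Fin n × Fin n → Fin n × Fin n → ℂ

/-- `wt n p = ω_n^{p₁ − p₂}`, `ω_n = exp(2πi/n)`: the `Ad(diag(ω^k))`-weight of the matrix unit
`e_p` (route docstring § Thesis). -/
def wt (n : ℕ) (p : Fin n × Fin n) : ℂ :=
  Complex.exp (2 * Real.pi * Complex.I / n) ^ ((p.1 : ℤ) - (p.2 : ℤ))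

/-- `𝒦`: the group-like generator of `T_n` acting on tensors (diagonal, leg by leg). -/
def Kop (n : ℕ) (t : Tn n) : Tn n :=
  fun a b c => wt n a * (wt n b)⁻¹ * (wt n c)⁻¹ * t a b c

/-- `𝒳`: the `(1,g)`-twisted derivation of `T_n` acting on tensors (route docstring § Thesis,
transcribed verbatim). -/
def Xop (n : ℕ) (t : Tn n) : Tn n :=
  fun a b c => (wt n b)⁻¹ * (wt n c)⁻¹ * ((∑ l : Fin n, if (l : ℕ) + 1 = (a.2 : ℕ) then t
    (a.1, l) b c else 0) - ∑ l : Fin n, if (a.1 : ℕ) + 1 = (l : ℕ) then wt n (l, a.2) * t (l, a.2) b c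
    else 0) - (wt n b)⁻¹ * ((∑ μ : Fin n, if (b.2 : ℕ) + 1 = (μ : ℕ) then t a (b.1, μ) c else 0) - ∑ k :
    Fin n, if (k : ℕ) + 1 = (b.1 : ℕ) then wt n b * t a (k, b.2) c else 0) - (wt n b)⁻¹ * (wt n c)⁻¹ *
    ((∑ μ : Fin n, if (c.2 : ℕ) + 1 = (μ : ℕ) then t a b (c.1, μ) else 0) - ∑ k : Fin n, if (k : ℕ) + 1
    = (c.1 : ℕ) then wt n c * t a b (k, c.2) else 0)

/-- A rank-one tensor `w ⊗ u ⊗ v` is a Taft-CLOSED SEED: `𝒳 t ∈ span {𝒦^k t : k < n}`. -/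
def IsClosedSeed (n : ℕ) (w u v : Fin n × Fin n → ℂ) : Prop :=
  ∃ c : Fin n → ℂ, Xop n (triad w u v) = ∑ k : Fin n, c k • ((Kop n)^[(k : ℕ)]) (triad w u v)

/-- A rank-one tensor is Taft-INVARIANT: `𝒦 t = t` and `𝒳 t = 0`. -/
def IsInvariantTriad (n : ℕ) (w u v : Fin n × Fin n → ℂ) : Prop :=
  Kop n (triad w u v) = triad w u v ∧ Xop n (triad w u v) = 0

/-- A TAFT SEED SCHEME of `⟨n,n,n⟩` with `s` seeds and `r₀` invariant terms:
`⟨n,n,n⟩ = Σ_j Σ_{k<n} 𝒦^k t_j + Σ_i t'_i`, seeds closed, residual terms invariant. -/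
def SeedScheme (n s r₀ : ℕ) : Prop :=
  ∃ (w u v : Fin s → Fin n × Fin n → ℂ) (w' u' v' : Fin r₀ → Fin n × Fin n → ℂ),
    (∀ j, IsClosedSeed n (w j) (u j) (v j)) ∧ (∀ i, IsInvariantTriad n (w' i) (u' i) (v' i)) ∧
    matMulTensor ℂ n n n = (∑ j, ∑ k : Fin n, ((Kop n)^[(k : ℕ)]) (triad (w j) (u j) (v j))) +
      ∑ i, triad (w' i) (u' i) (v' i)

/-- The same without any Taft condition: a plain `ℤ/n`-ORBIT SCHEME (orbit sums of arbitrary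
rank-ones plus arbitrary extra rank-ones). -/
def OrbitScheme (n s r₀ : ℕ) : Prop :=
  ∃ (w u v : Fin s → Fin n × Fin n → ℂ) (w' u' v' : Fin r₀ → Fin n × Fin n → ℂ),
    matMulTensor ℂ n n n = (∑ j, ∑ k : Fin n, ((Kop n)^[(k : ℕ)]) (triad (w j) (u j) (v j))) +
      ∑ i, triad (w' i) (u' i) (v' i)

/-- `X` unfolds to the named form DEFINITIONALLY (the route's `let`-telescope ζ/β-reduces to
`wt`, `Kop`, `Xop`). -/
theorem taftSeedSchemes_iff :
    TaftSeedSchemes ↔ ∀ ε : ℝ, 0 < ε → ∃ n : ℕ, 2 ≤ n ∧ ∃ s r₀ : ℕ,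
      ((n * s + r₀ : ℕ) : ℝ) ≤ (n : ℝ) ^ (2 + ε) ∧ SeedScheme n s r₀ :=
  Iff.rfl

theorem seedScheme_orbitScheme {n s r₀ : ℕ} (h : SeedScheme n s r₀) : OrbitScheme n s r₀ := by
  obtain ⟨w, u, v, w', u', v', -, -, hdec⟩ := h
  exact ⟨w, u, v, w', u', v', hdec⟩

/-! ## Structure (S0): orbit terms are triads; an orbit scheme is a plain decomposition -/

/-- `𝒦` acts leg by leg, so its iterates send triads to triads (as in the route's `closes`). -/
theorem iterate_Kop_triad (n : ℕ) (x y z : Fin n × Fin n → ℂ) (k : ℕ) :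
    (Kop n)^[k] (triad x y z) =
      triad (fun a => wt n a ^ k * x a) (fun b => ((wt n b)⁻¹) ^ k * y b)
        (fun c => ((wt n c)⁻¹) ^ k * z c) := by
  induction k with
  | zero =>
      funext a b c
      simp [triad]
  | succ k ih =>
      rw [Function.iterate_succ_apply', ih]
      funext a b c
      simp only [Kop, triad_apply, pow_succ]
      ring

/-- Forgetting every Taft condition: an orbit scheme with `s` seeds and `r₀` extra terms is a
decomposition of `⟨n,n,n⟩` into `n·s + r₀` triads, so `R(⟨n,n,n⟩) ≤ n·s + r₀`. This is the whole
content of the route's `closes`, and the reason every WITNESS-type piece below is summit-hard. -/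
theorem tensorRank_le_of_orbitScheme {n s r₀ : ℕ} (h : OrbitScheme n s r₀) :
    tensorRank (matMulTensor ℂ n n n) ≤ n * s + r₀ := by
  obtain ⟨w, u, v, w', u', v', hdec⟩ := h
  let W : (Fin s × Fin n) ⊕ Fin r₀ → Fin n × Fin n → ℂ := fun p => match p with
    | Sum.inl q => fun a => wt n a ^ (q.2 : ℕ) * w q.1 a
    | Sum.inr i => w' i
  let U : (Fin s × Fin n) ⊕ Fin r₀ → Fin n × Fin n → ℂ := fun p => match p with
    | Sum.inl q => fun b => ((wt n b)⁻¹) ^ (q.2 : ℕ) * u q.1 b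
    | Sum.inr i => u' i
  let V : (Fin s × Fin n) ⊕ Fin r₀ → Fin n × Fin n → ℂ := fun p => match p with
    | Sum.inl q => fun c => ((wt n c)⁻¹) ^ (q.2 : ℕ) * v q.1 c
    | Sum.inr i => v' i
  have hdec2 : matMulTensor ℂ n n n = ∑ p : (Fin s × Fin n) ⊕ Fin r₀, triad (W p) (U p) (V p) := by
    rw [Fintype.sum_sum_type, Fintype.sum_prod_type, hdec]
    congr 1
    refine Finset.sum_congr rfl fun j _ => Finset.sum_congr rfl fun k _ => ?_
    rw [iterate_Kop_triad]
  have h := tensorRank_le_card_of_eq_sum W U V hdec2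
  have hcard : Fintype.card ((Fin s × Fin n) ⊕ Fin r₀) = n * s + r₀ := by
    simp [Fintype.card_sum, Fintype.card_prod, Fintype.card_fin, Nat.mul_comm]
  simpa [hcard] using h

/-- From a rank bound `R(⟨n,n,n⟩) ≤ r ≤ n^{2+δ}` (`n ≥ 2`) to `ω(ℂ) ≤ 2 + δ` (Bläser Thm 5.9,
discharged in tree). -/
theorem omega_le_of_rank_le_rpow {n r : ℕ} {δ : ℝ} (hn : 2 ≤ n)
    (hrank : tensorRank (matMulTensor ℂ n n n) ≤ r) (hr : (r : ℝ) ≤ (n : ℝ) ^ (2 + δ)) :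
    omega ℂ ≤ 2 + δ := by
  have hω : omega ℂ ≤ Real.logb n r := omega_le_logb_of_rank_le' Blaser2013Thm59_holds ℂ hn hrank
  have hn1 : (1 : ℝ) < n := by exact_mod_cast hn
  have hn0 : (0 : ℝ) < n := by positivity
  have hlog : Real.logb n r ≤ 2 + δ := by
    rcases Nat.eq_zero_or_pos r with h0 | hpos
    · -- `r = 0` would give `2 ≤ ω(ℂ) ≤ logb n 0 = 0`: contradictory branch
      exfalso
      subst h0
      have h2 := omega_two_le ℂ
      simp only [CharP.cast_eq_zero, Real.logb_zero] at hω
      linarith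
    · have hr0 : (0 : ℝ) < (r : ℕ) := by exact_mod_cast hpos
      calc Real.logb n r ≤ Real.logb n ((n : ℝ) ^ (2 + δ)) := Real.logb_le_logb_of_le hn1 hr0 hr
        _ = 2 + δ := Real.logb_rpow hn0 (ne_of_gt hn1)
  linarith

/-! ## Attempt D2 — drop the Taft conditions: `X ⇐ CyclicOrbitSchemes ∧ ClosureUpgrade`

`CyclicOrbitSchemes` = `X` with closure and invariance forgotten (plain `ℤ/n`-diagonal orbit
schemes reach exponent two); `ClosureUpgrade` = "closure is free up to `n^ε`". Assembly proved
(ε/2-bookkeeping). (c) FAILS PROVABLY: `X → CyclicOrbitSchemes → S` (both below), so the witness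
piece is sandwiched between the crux and the summit. -/

/-- Piece D2.1: `ℤ/n`-orbit schemes of `⟨n,n,n⟩` reach exponent two. -/
def CyclicOrbitSchemes : Prop :=
  ∀ ε : ℝ, 0 < ε → ∃ n : ℕ, 2 ≤ n ∧ ∃ s r₀ : ℕ,
    ((n * s + r₀ : ℕ) : ℝ) ≤ (n : ℝ) ^ (2 + ε) ∧ OrbitScheme n s r₀

/-- Piece D2.2: any orbit scheme can be upgraded to a Taft seed scheme at cost factor `n^ε`. -/
def ClosureUpgrade : Prop :=
  ∀ ε : ℝ, 0 < ε → ∀ n : ℕ, 2 ≤ n → ∀ s r₀ : ℕ, OrbitScheme n s r₀ →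
    ∃ s' r₀' : ℕ, ((n * s' + r₀' : ℕ) : ℝ) ≤ (n : ℝ) ^ ε * ((n * s + r₀ : ℕ) : ℝ) ∧ SeedScheme n s' r₀'

/-- D2 assembly (proved). -/
theorem d2_assembly (h₁ : CyclicOrbitSchemes) (h₂ : ClosureUpgrade) : TaftSeedSchemes := by
  rw [taftSeedSchemes_iff]
  intro ε hε
  obtain ⟨n, hn, s, r₀, hb, horb⟩ := h₁ (ε / 2) (by positivity)
  obtain ⟨s', r₀', hb', hseed⟩ := h₂ (ε / 2) (by positivity) n hn s r₀ horb
  refine ⟨n, hn, s', r₀', ?_, hseed⟩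
  have hn0 : (0 : ℝ) < n := by exact_mod_cast (by omega : 0 < n)
  calc ((n * s' + r₀' : ℕ) : ℝ) ≤ (n : ℝ) ^ (ε / 2) * ((n * s + r₀ : ℕ) : ℝ) := hb'
    _ ≤ (n : ℝ) ^ (ε / 2) * (n : ℝ) ^ (2 + ε / 2) :=
        mul_le_mul_of_nonneg_left hb (Real.rpow_nonneg hn0.le _)
    _ = (n : ℝ) ^ (2 + ε) := by
        rw [← Real.rpow_add hn0]
        congr 1
        ring

/-- (c) for D2, first half: `X → CyclicOrbitSchemes` (forget the conditions). -/
theorem x_implies_cyclicOrbitSchemes (h : TaftSeedSchemes) : CyclicOrbitSchemes := by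
  rw [taftSeedSchemes_iff] at h
  intro ε hε
  obtain ⟨n, hn, s, r₀, hb, hseed⟩ := h ε hε
  exact ⟨n, hn, s, r₀, hb, seedScheme_orbitScheme hseed⟩

/-- (c) for D2, second half: `CyclicOrbitSchemes → S` — the witness piece is summit-hard on its
own (same proof as the route's `closes`, which never uses closure or invariance). -/
theorem cyclicOrbitSchemes_implies_summit (h : CyclicOrbitSchemes) : _root_.MatrixMultiplication := by
  rw [_root_.MatrixMultiplication_iff]
  refine le_antisymm (le_of_forall_pos_lt_add fun ε hε => ?_) (omega_two_le ℂ)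
  obtain ⟨n, hn, s, r₀, hb, horb⟩ := h (ε / 2) (by positivity)
  have := omega_le_of_rank_le_rpow hn (tensorRank_le_of_orbitScheme horb) hb
  linarith

/-! ## Attempt D3 — symmetrisation split: `X ⇐ TaftSeedFree ∧ OmegaTwoWitness`

The honest content anatomy of `X`: (Taft-closure is asymptotically free for decompositions of
`⟨n,n,n⟩`) ∧ (`ω = 2`). Assembly proved; (c) FAILS PROVABLY: `OmegaTwoWitness ⟺ S` (both
directions below). -/

/-- Piece D3.2: `R(⟨n,n,n⟩) ≤ n^{2+ε}` for all large `n` — `ω = 2` in witness form. -/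
def OmegaTwoWitness : Prop :=
  ∀ ε : ℝ, 0 < ε → ∃ N : ℕ, ∀ n : ℕ, N ≤ n →
    (tensorRank (matMulTensor ℂ n n n) : ℝ) ≤ (n : ℝ) ^ (2 + ε)

/-- Piece D3.1: Taft seed structure is asymptotically free — every decomposition of `⟨n,n,n⟩` of
length `r` (large `n`) yields a seed scheme of budget `≤ n^ε · r`. The seed-form analogue of the
route's support item `TaftClosureFree`. -/
def TaftSeedFree : Prop :=
  ∀ ε : ℝ, 0 < ε → ∃ N : ℕ, ∀ n : ℕ, N ≤ n → ∀ r : ℕ, ∀ (w u v : Fin r → Fin n × Fin n → ℂ),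
    matMulTensor ℂ n n n = ∑ i, triad (w i) (u i) (v i) →
      ∃ s r₀ : ℕ, ((n * s + r₀ : ℕ) : ℝ) ≤ (n : ℝ) ^ ε * (r : ℝ) ∧ SeedScheme n s r₀

/-- D3 assembly (proved). -/
theorem d3_assembly (h₁ : TaftSeedFree) (h₂ : OmegaTwoWitness) : TaftSeedSchemes := by
  rw [taftSeedSchemes_iff]
  intro ε hε
  obtain ⟨N₁, hN₁⟩ := h₁ (ε / 2) (by positivity)
  obtain ⟨N₂, hN₂⟩ := h₂ (ε / 2) (by positivity)
  set n : ℕ := max (max N₁ N₂) 2 with hn_def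
  have hn : 2 ≤ n := le_max_right _ _
  have hn1 : N₁ ≤ n := le_trans (le_max_left _ _) (le_max_left _ _)
  have hn2 : N₂ ≤ n := le_trans (le_max_right _ _) (le_max_left _ _)
  obtain ⟨w, u, v, hdec⟩ := exists_triad_decomposition_tensorRank (matMulTensor ℂ n n n)
  obtain ⟨s, r₀, hb, hseed⟩ := hN₁ n hn1 _ w u v hdec
  have hR := hN₂ n hn2
  refine ⟨n, hn, s, r₀, ?_, hseed⟩
  have hn0 : (0 : ℝ) < n := by exact_mod_cast (by omega : 0 < n)
  calc ((n * s + r₀ : ℕ) : ℝ)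
        ≤ (n : ℝ) ^ (ε / 2) * (tensorRank (matMulTensor ℂ n n n) : ℝ) := hb
    _ ≤ (n : ℝ) ^ (ε / 2) * (n : ℝ) ^ (2 + ε / 2) :=
        mul_le_mul_of_nonneg_left hR (Real.rpow_nonneg hn0.le _)
    _ = (n : ℝ) ^ (2 + ε) := by
        rw [← Real.rpow_add hn0]
        congr 1
        ring

/-- (c) for D3: the witness piece implies the summit. -/
theorem omegaTwoWitness_implies_summit (h : OmegaTwoWitness) : _root_.MatrixMultiplication := by
  rw [_root_.MatrixMultiplication_iff]
  refine le_antisymm (le_of_forall_pos_lt_add fun ε hε => ?_) (omega_two_le ℂ)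
  obtain ⟨N, hN⟩ := h (ε / 2) (by positivity)
  have hn : 2 ≤ max N 2 := le_max_right _ _
  have hR := hN (max N 2) (le_max_left _ _)
  have := omega_le_of_rank_le_rpow hn le_rfl hR
  linarith

/-- (c) for D3, converse: the summit implies the witness piece. So `OmegaTwoWitness ⟺ S`. -/
theorem summit_implies_omegaTwoWitness (h : _root_.MatrixMultiplication) : OmegaTwoWitness := by
  intro ε hε
  have hadm : (2 + ε / 2) ∈ admissibleExponents ℂ :=
    (matrixMultiplication_iff_forall_pos.1 h) (ε / 2) (by positivity)
  obtain ⟨c, hc⟩ := Asymptotics.IsBigO.bound hadm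
  rw [Filter.eventually_atTop] at hc
  obtain ⟨n₀, hn₀⟩ := hc
  -- threshold making `max c 1 ≤ n^{ε/2}`
  set y : ℝ := (max c 1) ^ (2 / ε) with hy
  have hy0 : 0 ≤ y := Real.rpow_nonneg (le_trans zero_le_one (le_max_right _ _)) _
  refine ⟨max (max n₀ ⌈y⌉₊) 1, fun n hn => ?_⟩
  have hnn₀ : n₀ ≤ n := le_trans (le_trans (le_max_left _ _) (le_max_left _ _)) hn
  have hny : y ≤ n := le_trans (Nat.le_ceil y)
    (by exact_mod_cast le_trans (le_trans (le_max_right _ _) (le_max_left _ _)) hn)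
  have hn1 : 1 ≤ n := le_trans (le_max_right _ _) hn
  have hbd := hn₀ n hnn₀
  rw [Real.norm_of_nonneg (Nat.cast_nonneg _),
    Real.norm_of_nonneg (Real.rpow_nonneg (Nat.cast_nonneg _) _)] at hbd
  have hn0 : (0 : ℝ) ≤ n := Nat.cast_nonneg _
  have hpos : (0 : ℝ) < n := by exact_mod_cast (by omega : 0 < n)
  have hmax : max c 1 ≤ (n : ℝ) ^ (ε / 2) := by
    have h1 : max c 1 = y ^ (ε / 2) := by
      rw [hy, ← Real.rpow_mul (le_trans zero_le_one (le_max_right _ _))]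
      have : 2 / ε * (ε / 2) = 1 := by field_simp
      rw [this, Real.rpow_one]
    rw [h1]
    exact Real.rpow_le_rpow hy0 hny (by positivity)
  calc (tensorRank (matMulTensor ℂ n n n) : ℝ) ≤ c * (n : ℝ) ^ (2 + ε / 2) := hbd
    _ ≤ max c 1 * (n : ℝ) ^ (2 + ε / 2) :=
        mul_le_mul_of_nonneg_right (le_max_left _ _) (Real.rpow_nonneg hn0 _)
    _ ≤ (n : ℝ) ^ (ε / 2) * (n : ℝ) ^ (2 + ε / 2) :=
        mul_le_mul_of_nonneg_right hmax (Real.rpow_nonneg hn0 _)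
    _ = (n : ℝ) ^ (2 + ε) := by
        rw [← Real.rpow_add hpos]
        congr 1
        ring

/-! ## Attempt D1 — the route's own two-layer plan: `X ⇐ SeedSupply ∧ ResidualBound`

`SeedSupply`: closed seeds within budget whose residual is SOME sum of invariant rank-ones (their
number unconstrained). `ResidualBound`: any sum of invariant rank-ones equals a sum of at most `n²`
of them. Assembly proved. (c) fails because `ResidualBound` is TRUE (structure fact (S2) of the
census: the Taft-invariant rank-ones are exactly `n²` lines — legs in the `n`-dimensional kernels of
the nilpotent leg operators, plus the weight condition — verified numerically for `n ≤ 6`), so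
`SeedSupply` is `X` in costume; it is also summit-hard by `tensorRank_le_of_orbitScheme` once the
residual is re-expressed with `≤ n²` terms. -/

/-- Piece D1.1. -/
def SeedSupply : Prop :=
  ∀ ε : ℝ, 0 < ε → ∃ n : ℕ, 2 ≤ n ∧ ∃ s : ℕ,
    ((n * s + n ^ 2 : ℕ) : ℝ) ≤ (n : ℝ) ^ (2 + ε) ∧ ∃ r : ℕ, SeedScheme n s r

/-- Piece D1.2 (TRUE; census (S2)). -/
def ResidualBound : Prop :=
  ∀ n r : ℕ, ∀ (w' u' v' : Fin r → Fin n × Fin n → ℂ), (∀ i, IsInvariantTriad n (w' i) (u' i) (v' i)) →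
    ∃ r₁ : ℕ, r₁ ≤ n ^ 2 ∧ ∃ (w'' u'' v'' : Fin r₁ → Fin n × Fin n → ℂ),
      (∀ i, IsInvariantTriad n (w'' i) (u'' i) (v'' i)) ∧
      ∑ i, triad (w'' i) (u'' i) (v'' i) = ∑ i, triad (w' i) (u' i) (v' i)

/-- D1 assembly (proved). -/
theorem d1_assembly (h₁ : SeedSupply) (h₂ : ResidualBound) : TaftSeedSchemes := by
  rw [taftSeedSchemes_iff]
  intro ε hε
  obtain ⟨n, hn, s, hb, r, w, u, v, w', u', v', hcl, hinv, hdec⟩ := h₁ ε hε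
  obtain ⟨r₁, hr₁, w'', u'', v'', hinv'', hsum⟩ := h₂ n r w' u' v' hinv
  refine ⟨n, hn, s, r₁, ?_, w, u, v, w'', u'', v'', hcl, hinv'', ?_⟩
  · calc ((n * s + r₁ : ℕ) : ℝ) ≤ ((n * s + n ^ 2 : ℕ) : ℝ) := by exact_mod_cast (by omega)
      _ ≤ (n : ℝ) ^ (2 + ε) := hb
  · rw [hsum]
    exact hdec

/-! ## Attempt D4 — spark ∧ propagation: `X ⇐ TaftSpark ∧ LevelRaising`

A finite spark (some seed scheme of `⟨n,n,n⟩` of budget `≤ n^{2+e₀}`; TRUE at `n = 2`: Strassen's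
scheme in Taft position, `s = 3`, `r₀ = 1`, budget `7 = 2^{2.807…}`, support item `TaftTwo`) and a
uniform contraction of the exponent excess. The assembly is a genuine iteration (proved). It fails
(c) in substance — given the provable spark, `LevelRaising` alone carries `X` — and has no
mechanism: the Taft structure at `n·m` is not the product of the structures at `n` and `m`
(`ω_{nm}`-weights do not factor), so not even the Strassen-type product of two seed schemes is a
seed scheme; a fortiori nothing contracts the excess. -/

/-- Piece D4.1 (true via `TaftTwo`). -/
def TaftSpark : Prop :=
  ∃ e₀ : ℝ, 0 ≤ e₀ ∧ ∃ n : ℕ, 2 ≤ n ∧ ∃ s r₀ : ℕ,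
    ((n * s + r₀ : ℕ) : ℝ) ≤ (n : ℝ) ^ (2 + e₀) ∧ SeedScheme n s r₀

/-- Piece D4.2: uniform contraction of the exponent excess of seed schemes. -/
def LevelRaising : Prop :=
  ∃ θ : ℝ, 0 ≤ θ ∧ θ < 1 ∧ ∀ e : ℝ, 0 ≤ e → ∀ n : ℕ, 2 ≤ n → ∀ s r₀ : ℕ,
    ((n * s + r₀ : ℕ) : ℝ) ≤ (n : ℝ) ^ (2 + e) → SeedScheme n s r₀ →
      ∃ n' : ℕ, 2 ≤ n' ∧ ∃ s' r₀' : ℕ,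
        ((n' * s' + r₀' : ℕ) : ℝ) ≤ (n' : ℝ) ^ (2 + θ * e) ∧ SeedScheme n' s' r₀'

/-- D4 assembly (proved; a `k`-fold iteration, `θ^k e₀ < ε`). -/
theorem d4_assembly (h₁ : TaftSpark) (h₂ : LevelRaising) : TaftSeedSchemes := by
  rw [taftSeedSchemes_iff]
  obtain ⟨e₀, he₀, hsp⟩ := h₁
  obtain ⟨θ, hθ0, hθ1, hstep⟩ := h₂
  -- after k steps the excess is at most θ^k · e₀
  have iter : ∀ k : ℕ, ∃ n : ℕ, 2 ≤ n ∧ ∃ s r₀ : ℕ,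
      ((n * s + r₀ : ℕ) : ℝ) ≤ (n : ℝ) ^ (2 + θ ^ k * e₀) ∧ SeedScheme n s r₀ := by
    intro k
    induction k with
    | zero => simpa using hsp
    | succ k ih =>
        obtain ⟨n, hn, s, r₀, hb, hseed⟩ := ih
        obtain ⟨n', hn', s', r₀', hb', hseed'⟩ :=
          hstep (θ ^ k * e₀) (by positivity) n hn s r₀ hb hseed
        refine ⟨n', hn', s', r₀', ?_, hseed'⟩
        have : θ * (θ ^ k * e₀) = θ ^ (k + 1) * e₀ := by ring
        rw [← this]
        exact hb'
  intro ε hε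
  obtain ⟨k, hk⟩ := exists_pow_lt_of_lt_one (show 0 < ε / (e₀ + 1) by positivity) hθ1
  obtain ⟨n, hn, s, r₀, hb, hseed⟩ := iter k
  refine ⟨n, hn, s, r₀, le_trans hb ?_, hseed⟩
  have hn1 : (1 : ℝ) ≤ n := by exact_mod_cast (by omega : 1 ≤ n)
  apply Real.rpow_le_rpow_of_exponent_le hn1
  have hθk : 0 ≤ θ ^ k := pow_nonneg hθ0 k
  have : θ ^ k * e₀ ≤ θ ^ k * (e₀ + 1) := mul_le_mul_of_nonneg_left (by linarith) hθk
  have h2 : θ ^ k * (e₀ + 1) < ε / (e₀ + 1) * (e₀ + 1) :=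
    mul_lt_mul_of_pos_right hk (by positivity)
  rw [div_mul_cancel₀ _ (by positivity : (e₀ + 1) ≠ 0)] at h2
  linarith

end Summit.MatrixMultiplication.MatrixMultiplication.Cruxes.TaftSeedSchemes.Strategist
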